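import Summits.NavierStokesRegularity.NavierStokesRegularity.Theorems.OddMorawetzMorawetzKillsTypeIIsoNullThree8

/-!
# Crux `MorawetzKillsTypeI` — `stub_isoNullThree`: the seventeen weight-3 null-Lagrangian certificates

Assembly of the registered statement of the line's skeleton (crux stmt-NavierStokesRegularity-1377): each
`δ`-contraction `I_l` of weight 3 is `C¹` (indeed smooth: `IsoNullThree.smoothI_l`), and `I_l - α_l r` has Euler pairing
with `B(v,v)` of integral zero along divergence-free Schwartz fields (`IsoNullThree.nullInt_l`, the generated certificates:
total divergences of explicit polynomial fluxes of the 2-jet, transferred by `stub_nullTransfer`). Everything is proved;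
no definitions.
-/

noncomputable section

open scoped BigOperators

set_option linter.dupNamespace false

namespace Summit.NavierStokesRegularity.NavierStokesRegularity.Theorems

open Summit.NavierStokesRegularity.NavierStokesRegularity.Theorems.OddMorawetz

set_option linter.unusedVariables false in
/-- **`stub_isoNullThree`** (crux stmt-NavierStokesRegularity-1377, line `registered`): the seventeen `δ`-contractions
`I_l` of weight 3 are `C¹`, and each `I_l - α_l r` (`r = ω · ∇u ω`, `α = (0,-1,0,0,0,1,0,0,1,0,…,0,-1,0)`) has Euler pairing
with `B(v,v)` of integral zero along every divergence-free Schwartz field `v`. (The registered statement shares its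
`let`-block with `stub_isoStructureThree`; the symmetry predicate `Symm` is not used by THIS statement, whence the
`unusedVariables` exemption.) -/
theorem stub_isoNullThree :
    let e : Fin 3 → E3 := fun i => EuclideanSpace.single i (1 : ℝ);
    let ω : (E3 [×1]→L[ℝ] E3) → E3 := fun A =>
      WithLp.toLp 2 ![A (fun _ => e 1) 2 - A (fun _ => e 2) 1, A (fun _ => e 2) 0 - A (fun _ => e 0) 2,
        A (fun _ => e 0) 1 - A (fun _ => e 1) 0];
    let r : Jet3 → ℝ := fun z => inner ℝ (ω z.2.1) (z.2.1 (fun _ => ω z.2.1));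
    let I0 : Jet3 → ℝ := fun z => ∑ i0 : Fin 3, ∑ i1 : Fin 3, ∑ i2 : Fin 3, z.1 i0 * z.1 i0 * z.2.2.2 ![e i1, e i2, e i2] i1;
    let I1 : Jet3 → ℝ := fun z => ∑ i0 : Fin 3, ∑ i1 : Fin 3, ∑ i2 : Fin 3, z.1 i0 * z.1 i1 * z.2.2.2 ![e i1, e i2, e i2] i0;
    let I2 : Jet3 → ℝ := fun z => ∑ i0 : Fin 3, ∑ i1 : Fin 3, ∑ i2 : Fin 3, z.1 i0 * z.1 i1 * z.2.2.2 ![e i0, e i1, e i2] i2;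
    let I3 : Jet3 → ℝ := fun z => ∑ i0 : Fin 3, ∑ i1 : Fin 3, ∑ i2 : Fin 3, z.1 i0 * z.2.1 (fun _ => e i1) i0 * z.2.2.1 ![e i2, e i2] i1;
    let I4 : Jet3 → ℝ := fun z => ∑ i0 : Fin 3, ∑ i1 : Fin 3, ∑ i2 : Fin 3, z.1 i0 * z.2.1 (fun _ => e i1) i0 * z.2.2.1 ![e i1, e i2] i2;
    let I5 : Jet3 → ℝ := fun z => ∑ i0 : Fin 3, ∑ i1 : Fin 3, ∑ i2 : Fin 3, z.1 i0 * z.2.1 (fun _ => e i0) i1 * z.2.2.1 ![e i2, e i2] i1;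
    let I6 : Jet3 → ℝ := fun z => ∑ i0 : Fin 3, ∑ i1 : Fin 3, ∑ i2 : Fin 3, z.1 i0 * z.2.1 (fun _ => e i0) i1 * z.2.2.1 ![e i1, e i2] i2;
    let I7 : Jet3 → ℝ := fun z => ∑ i0 : Fin 3, ∑ i1 : Fin 3, ∑ i2 : Fin 3, z.1 i0 * z.2.1 (fun _ => e i1) i1 * z.2.2.1 ![e i2, e i2] i0;
    let I8 : Jet3 → ℝ := fun z => ∑ i0 : Fin 3, ∑ i1 : Fin 3, ∑ i2 : Fin 3, z.1 i0 * z.2.1 (fun _ => e i2) i1 * z.2.2.1 ![e i1, e i2] i0;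
    let I9 : Jet3 → ℝ := fun z => ∑ i0 : Fin 3, ∑ i1 : Fin 3, ∑ i2 : Fin 3, z.1 i0 * z.2.1 (fun _ => e i1) i1 * z.2.2.1 ![e i0, e i2] i2;
    let I10 : Jet3 → ℝ := fun z => ∑ i0 : Fin 3, ∑ i1 : Fin 3, ∑ i2 : Fin 3, z.1 i0 * z.2.1 (fun _ => e i2) i1 * z.2.2.1 ![e i0, e i2] i1;
    let I11 : Jet3 → ℝ := fun z => ∑ i0 : Fin 3, ∑ i1 : Fin 3, ∑ i2 : Fin 3, z.1 i0 * z.2.1 (fun _ => e i2) i1 * z.2.2.1 ![e i0, e i1] i2;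
    let I12 : Jet3 → ℝ := fun z => ∑ i0 : Fin 3, ∑ i1 : Fin 3, ∑ i2 : Fin 3, z.2.1 (fun _ => e i0) i0 * z.2.1 (fun _ => e i1) i1 * z.2.1 (fun _ => e i2) i2;
    let I13 : Jet3 → ℝ := fun z => ∑ i0 : Fin 3, ∑ i1 : Fin 3, ∑ i2 : Fin 3, z.2.1 (fun _ => e i0) i0 * z.2.1 (fun _ => e i2) i1 * z.2.1 (fun _ => e i2) i1;
    let I14 : Jet3 → ℝ := fun z => ∑ i0 : Fin 3, ∑ i1 : Fin 3, ∑ i2 : Fin 3, z.2.1 (fun _ => e i0) i0 * z.2.1 (fun _ => e i2) i1 * z.2.1 (fun _ => e i1) i2;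
    let I15 : Jet3 → ℝ := fun z => ∑ i0 : Fin 3, ∑ i1 : Fin 3, ∑ i2 : Fin 3, z.2.1 (fun _ => e i1) i0 * z.2.1 (fun _ => e i2) i0 * z.2.1 (fun _ => e i2) i1;
    let I16 : Jet3 → ℝ := fun z => ∑ i0 : Fin 3, ∑ i1 : Fin 3, ∑ i2 : Fin 3, z.2.1 (fun _ => e i1) i0 * z.2.1 (fun _ => e i0) i2 * z.2.1 (fun _ => e i2) i1;
    let I : Fin 17 → Jet3 → ℝ := ![I0, I1, I2, I3, I4, I5, I6, I7, I8, I9, I10, I11, I12, I13, I14, I15, I16];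
    let α : Fin 17 → ℝ := ![0, -1, 0, 0, 0, 1, 0, 0, 1, 0, 0, 0, 0, 0, 0, -1, 0];
    let Symm : Jet3 → Prop := fun z =>
      (∀ (h : Fin 2 → E3) (σ : Equiv.Perm (Fin 2)), z.2.2.1 (h ∘ σ) = z.2.2.1 h) ∧
      (∀ (h : Fin 3 → E3) (σ : Equiv.Perm (Fin 3)), z.2.2.2 (h ∘ σ) = z.2.2.2 h);
    let J := fun (v : E3 → E3) (x : E3) => ((v x, iteratedFDeriv ℝ 1 v x, iteratedFDeriv ℝ 2 v x, iteratedFDeriv ℝ 3 v x) : Jet3);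
    (∀ l : Fin 17, ContDiff ℝ 1 (I l)) ∧
    ∀ (l : Fin 17) (v : E3 → E3), Literature.Analysis.FluidPDE.IsSchwartzField v →
      Literature.Analysis.FluidPDE.VectorCalculus.IsDivFree v →
      ∫ x, fderiv ℝ (fun z => I l z - α l * r z) (J v x) (J (Literature.Analysis.FluidPDE.eulerBilinear v v) x) = 0 := by
  intro e ω r I0 I1 I2 I3 I4 I5 I6 I7 I8 I9 I10 I11 I12 I13 I14 I15 I16 I α Symm J
  refine ⟨fun l => ?_, fun l v hv hdiv => ?_⟩
  · fin_cases l <;> simp only [I, Fin.isValue, Fin.reduceFinMk, Matrix.cons_val_zero, Matrix.cons_val_one, Matrix.cons_val_two, Matrix.head_cons,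
      Matrix.tail_cons, Matrix.cons_val]
    · exact IsoNullThree.smoothI_0.of_le (by exact_mod_cast le_top)
    · exact IsoNullThree.smoothI_1.of_le (by exact_mod_cast le_top)
    · exact IsoNullThree.smoothI_2.of_le (by exact_mod_cast le_top)
    · exact IsoNullThree.smoothI_3.of_le (by exact_mod_cast le_top)
    · exact IsoNullThree.smoothI_4.of_le (by exact_mod_cast le_top)
    · exact IsoNullThree.smoothI_5.of_le (by exact_mod_cast le_top)
    · exact IsoNullThree.smoothI_6.of_le (by exact_mod_cast le_top)
    · exact IsoNullThree.smoothI_7.of_le (by exact_mod_cast le_top)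
    · exact IsoNullThree.smoothI_8.of_le (by exact_mod_cast le_top)
    · exact IsoNullThree.smoothI_9.of_le (by exact_mod_cast le_top)
    · exact IsoNullThree.smoothI_10.of_le (by exact_mod_cast le_top)
    · exact IsoNullThree.smoothI_11.of_le (by exact_mod_cast le_top)
    · exact IsoNullThree.smoothI_12.of_le (by exact_mod_cast le_top)
    · exact IsoNullThree.smoothI_13.of_le (by exact_mod_cast le_top)
    · exact IsoNullThree.smoothI_14.of_le (by exact_mod_cast le_top)
    · exact IsoNullThree.smoothI_15.of_le (by exact_mod_cast le_top)
    · exact IsoNullThree.smoothI_16.of_le (by exact_mod_cast le_top)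
  · fin_cases l <;> simp only [I, α, Fin.isValue, Fin.reduceFinMk, Matrix.cons_val_zero, Matrix.cons_val_one, Matrix.cons_val_two, Matrix.head_cons,
      Matrix.tail_cons, Matrix.cons_val]
    · exact IsoNullThree.nullInt_0 v hv hdiv
    · exact IsoNullThree.nullInt_1 v hv hdiv
    · exact IsoNullThree.nullInt_2 v hv hdiv
    · exact IsoNullThree.nullInt_3 v hv hdiv
    · exact IsoNullThree.nullInt_4 v hv hdiv
    · exact IsoNullThree.nullInt_5 v hv hdiv
    · exact IsoNullThree.nullInt_6 v hv hdiv
    · exact IsoNullThree.nullInt_7 v hv hdiv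
    · exact IsoNullThree.nullInt_8 v hv hdiv
    · exact IsoNullThree.nullInt_9 v hv hdiv
    · exact IsoNullThree.nullInt_10 v hv hdiv
    · exact IsoNullThree.nullInt_11 v hv hdiv
    · exact IsoNullThree.nullInt_12 v hv hdiv
    · exact IsoNullThree.nullInt_13 v hv hdiv
    · exact IsoNullThree.nullInt_14 v hv hdiv
    · exact IsoNullThree.nullInt_15 v hv hdiv
    · exact IsoNullThree.nullInt_16 v hv hdiv

end Summit.NavierStokesRegularity.NavierStokesRegularity.Theorems

end

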